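import Summits.NavierStokesRegularity.NavierStokesRegularity.Theorems.ExtremiserTransienceWeakClassPressureOsc
import Literature.Analysis.FluidPDE.WholeSpaceIBP
import Literature.Analysis.FluidPDE.MildSolutionProofs
import HarnessLib

/-!
# Route `ExtremiserTransience`, LINE g5-α repair (seat ns-idea-5 g5): slice-wise bound of the gauge-free energy flux

`--supports stmt-NavierStokesRegularity-27823` (§RECIPE step 4a).  Route-independent module.  For a member `(W, K)` of the weak one-slice class there is
`B = B(W) ≥ 0` with, for every `ρ > 0` and every `s < 0`,
`∫ (Δχ_ρ |W s|² + Dχ_ρ(W s)|W s|² + 2 (Q̃_s − Q̃_s(0)) Dχ_ρ(W s)) ≤ B · (ρ/(−s) + ρ²/((−s)√(−s)) + ρ²/(s²√(−s)) + ρ²√(1+2ρ)/((−s)√(−s)))`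
(`χ_ρ = cutoff ρ`, `Q̃_s = pressurePotentialMod 0 (W s)`): the integrand vanishes off `B̄_{2ρ}` (volume `8ρ³·|B̄₁|`) and is bounded pointwise by
`(C/ρ²) N² + (C/ρ) N³ + 2 (A₁/s² + A₂√(1+2ρ)/(−s)) (C/ρ) N` with `N = K/√(−s)` (cutoff bounds `exists_norm_fderiv_cutoff_le`,
`exists_abs_laplacian_cutoff_le`, Type-I decay, and the pressure oscillation bound `weakClass_pressureOsc`, p640175).  Together with
`weakClass_localEnergy_head'` what remains of the 27823 budget is one time integration (`∫_{t₀−ρ²}^{t₀} ds/(−s) = log(1 + ρ²/(−t₀))`,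
`(−s)^{−1/2} ≤ (−t₀)^{−1/2}` on the window) and monomial bookkeeping giving `C ρ^{11/4}` (any exponent `< 3` closes 27823 by
`plateauSliceRigidity_of_subcubicBudget`).  HONEST FRAMING: bookkeeping for hypothetical blow-up limits; nothing about Navier–Stokes regularity
or blow-up is proved here and no summit is proved by a line. [cite: CaffarelliKohnNirenberg1982, §2 (2.5)]
-/

noncomputable section

namespace Summit.NavierStokesRegularity.NavierStokesRegularity.Theorems.ExtremiserTransience
set_option linter.dupNamespace false

open Set Function MeasureTheory Filter Topology Metric
open scoped RealInnerProductSpace ContDiff Laplacian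
open Literature.Analysis Literature.Analysis.FluidPDE

/-- **Slice-wise flux bound** for weak-class fields (§RECIPE step 4a of the 27823 budget). [cite: CaffarelliKohnNirenberg1982, §2 (2.5)] -/
theorem weakClass_flux_pointwise (W : ℝ → EuclideanSpace ℝ (Fin 3) → EuclideanSpace ℝ (Fin 3)) (K : ℝ)
    (hcont : ContinuousOn (Function.uncurry W) (Set.Iio (0 : ℝ) ×ˢ Set.univ))
    (hmild : ∀ s t : ℝ, s < t → t < 0 → ∀ x, W t x =
      Literature.Analysis.FluidPDE.heatFlow (W s) (t - s) x - Literature.Analysis.FluidPDE.oseenDuhamel 1 s W W t x)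
    (hdec : ∀ t : ℝ, t < 0 → ∀ x, Real.sqrt (-t) * ‖W t x‖ ≤ K) :
    ∃ B : ℝ, 0 ≤ B ∧ ∀ ρ : ℝ, 0 < ρ → ∀ s : ℝ, s < 0 →
      (∫ x, ((Δ (cutoff ρ : EuclideanSpace ℝ (Fin 3) → ℝ)) x * ‖W s x‖ ^ 2 +
          fderiv ℝ (cutoff ρ) x (W s x) * ‖W s x‖ ^ 2 +
          2 * ((pressurePotentialMod 0 (W s) x - pressurePotentialMod 0 (W s) 0) * fderiv ℝ (cutoff ρ) x (W s x)))) ≤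
        B * (ρ / (-s) + ρ ^ 2 / ((-s) * Real.sqrt (-s)) + ρ ^ 2 / (s ^ 2 * Real.sqrt (-s)) +
          ρ ^ 2 * Real.sqrt (1 + 2 * ρ) / ((-s) * Real.sqrt (-s))) := by
  obtain ⟨C₁, hC₁0, hC₁⟩ := exists_norm_fderiv_cutoff_le (E := EuclideanSpace ℝ (Fin 3))
  obtain ⟨C₂, hC₂0, hC₂⟩ := exists_abs_laplacian_cutoff_le (E := EuclideanSpace ℝ (Fin 3))
  obtain ⟨A₁, A₂, hA₁, hA₂, hosc⟩ := weakClass_pressureOsc W K hcont hmild hdec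
  have hK : 0 ≤ K := le_trans (mul_nonneg (Real.sqrt_nonneg _) (norm_nonneg _)) (hdec (-1) (by norm_num) 0)
  set V₁ : ℝ := volume.real (closedBall (0 : EuclideanSpace ℝ (Fin 3)) 1) with hV₁
  have hV₁0 : 0 ≤ V₁ := measureReal_nonneg
  refine ⟨8 * V₁ * (C₂ * K ^ 2 + C₁ * K ^ 3 + 2 * C₁ * K * A₁ + 2 * C₁ * K * A₂), by positivity, fun ρ hρ s hs => ?_⟩
  have hs' : 0 < -s := neg_pos.2 hs
  have hsq : 0 < Real.sqrt (-s) := Real.sqrt_pos.2 hs'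
  have hsq2 : Real.sqrt (-s) ^ 2 = -s := Real.sq_sqrt hs'.le
  set N : ℝ := K / Real.sqrt (-s) with hN
  have hN0 : 0 ≤ N := div_nonneg hK hsq.le
  have hWN : ∀ x, ‖W s x‖ ≤ N := fun x => by
    rw [hN, le_div_iff₀ hsq, mul_comm]; exact hdec s hs x
  set φ : EuclideanSpace ℝ (Fin 3) → ℝ := cutoff ρ with hφdef
  -- the pointwise bound `M`
  set Osc : ℝ := A₁ / s ^ 2 + A₂ / (-s) * Real.sqrt (1 + 2 * ρ) with hOsc
  have hOsc0 : 0 ≤ Osc := by positivity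
  set M : ℝ := C₂ / ρ ^ 2 * N ^ 2 + C₁ / ρ * N ^ 3 + 2 * (Osc * (C₁ / ρ * N)) with hM
  have hM0 : 0 ≤ M := by positivity
  set f : EuclideanSpace ℝ (Fin 3) → ℝ := fun x => (Δ φ) x * ‖W s x‖ ^ 2 + fderiv ℝ φ x (W s x) * ‖W s x‖ ^ 2 +
      2 * ((pressurePotentialMod 0 (W s) x - pressurePotentialMod 0 (W s) 0) * fderiv ℝ φ x (W s x)) with hf
  -- support of the cutoff
  have htsupp : tsupport φ ⊆ closedBall (0 : EuclideanSpace ℝ (Fin 3)) (2 * ρ) := by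
    refine closure_minimal (fun y hy => ?_) isClosed_closedBall
    rw [mem_closedBall_zero_iff]
    by_contra h
    exact hy (cutoff_eq_zero hρ (not_le.1 h).le)
  have hzero : ∀ x, x ∉ closedBall (0 : EuclideanSpace ℝ (Fin 3)) (2 * ρ) → f x = 0 := by
    intro x hx
    have hx' : x ∉ tsupport φ := fun h => hx (htsupp h)
    have hD : fderiv ℝ φ x = 0 := Function.notMem_support.1 fun h => hx' (support_fderiv_subset ℝ h)
    have hL : (Δ φ) x = 0 := laplacian_eq_zero_of_notMem_tsupport hx'
    simp [hf, hD, hL]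
  -- pointwise bound on the closed ball
  have hbound : ∀ x ∈ closedBall (0 : EuclideanSpace ℝ (Fin 3)) (2 * ρ), ‖f x‖ ≤ M := by
    intro x hx
    rw [mem_closedBall_zero_iff] at hx
    have h1 : |(Δ φ) x * ‖W s x‖ ^ 2| ≤ C₂ / ρ ^ 2 * N ^ 2 := by
      rw [abs_mul, abs_of_nonneg (by positivity : (0 : ℝ) ≤ ‖W s x‖ ^ 2)]
      exact mul_le_mul (hC₂ ρ hρ x) (pow_le_pow_left₀ (norm_nonneg _) (hWN x) 2) (by positivity) (by positivity)
    have hDW : |fderiv ℝ φ x (W s x)| ≤ C₁ / ρ * N := by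
      rw [← Real.norm_eq_abs]
      exact (ContinuousLinearMap.le_opNorm _ _).trans (mul_le_mul (hC₁ ρ hρ x) (hWN x) (norm_nonneg _) (by positivity))
    have h2 : |fderiv ℝ φ x (W s x) * ‖W s x‖ ^ 2| ≤ C₁ / ρ * N ^ 3 := by
      rw [abs_mul, abs_of_nonneg (by positivity : (0 : ℝ) ≤ ‖W s x‖ ^ 2)]
      calc |fderiv ℝ φ x (W s x)| * ‖W s x‖ ^ 2 ≤ (C₁ / ρ * N) * N ^ 2 :=
            mul_le_mul hDW (pow_le_pow_left₀ (norm_nonneg _) (hWN x) 2) (by positivity) (by positivity)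
        _ = C₁ / ρ * N ^ 3 := by ring
    have hO : |pressurePotentialMod 0 (W s) x - pressurePotentialMod 0 (W s) 0| ≤ Osc := by
      refine (hosc s hs 0 x 0).trans ?_
      have hx1 : Real.sqrt (1 + ‖x - 0‖) ≤ Real.sqrt (1 + 2 * ρ) := by
        rw [sub_zero]; exact Real.sqrt_le_sqrt (by linarith)
      have : A₂ / (-s) * Real.sqrt (1 + ‖x - 0‖) ≤ A₂ / (-s) * Real.sqrt (1 + 2 * ρ) :=
        mul_le_mul_of_nonneg_left hx1 (by positivity)
      linarith
    have h3 : |2 * ((pressurePotentialMod 0 (W s) x - pressurePotentialMod 0 (W s) 0) * fderiv ℝ φ x (W s x))| ≤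
        2 * (Osc * (C₁ / ρ * N)) := by
      rw [abs_mul, abs_of_pos (by norm_num : (0 : ℝ) < 2), abs_mul]
      exact mul_le_mul_of_nonneg_left (mul_le_mul hO hDW (abs_nonneg _) hOsc0) (by norm_num)
    rw [Real.norm_eq_abs]
    calc |f x| ≤ |(Δ φ) x * ‖W s x‖ ^ 2 + fderiv ℝ φ x (W s x) * ‖W s x‖ ^ 2| +
          |2 * ((pressurePotentialMod 0 (W s) x - pressurePotentialMod 0 (W s) 0) * fderiv ℝ φ x (W s x))| := abs_add_le _ _
      _ ≤ (|(Δ φ) x * ‖W s x‖ ^ 2| + |fderiv ℝ φ x (W s x) * ‖W s x‖ ^ 2|) +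
          |2 * ((pressurePotentialMod 0 (W s) x - pressurePotentialMod 0 (W s) 0) * fderiv ℝ φ x (W s x))| := by
          gcongr; exact abs_add_le _ _
      _ ≤ M := by rw [hM]; linarith
  -- integrate over the closed ball
  have hvol : volume.real (closedBall (0 : EuclideanSpace ℝ (Fin 3)) (2 * ρ)) = 8 * ρ ^ 3 * V₁ := by
    rw [Measure.addHaar_real_closedBall' volume (0 : EuclideanSpace ℝ (Fin 3)) (by positivity : (0 : ℝ) ≤ 2 * ρ),
      finrank_euclideanSpace_fin]
    ring
  have hfin : volume (closedBall (0 : EuclideanSpace ℝ (Fin 3)) (2 * ρ)) < ⊤ := measure_closedBall_lt_top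
  have hint : (∫ x, f x) ≤ M * (8 * ρ ^ 3 * V₁) := by
    rw [← setIntegral_eq_integral_of_forall_compl_eq_zero hzero, ← hvol]
    exact (le_abs_self _).trans (by simpa [Real.norm_eq_abs] using norm_setIntegral_le_of_norm_le_const hfin hbound)
  -- bookkeeping: `M · 8ρ³V₁ ≤ B · (…)`
  have hρ0 : ρ ≠ 0 := hρ.ne'
  have hsq0 : Real.sqrt (-s) ≠ 0 := hsq.ne'
  have hs0 : s ≠ 0 := hs.ne
  have hN2 : N ^ 2 = K ^ 2 / (-s) := by rw [hN, div_pow, hsq2]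
  have hN3 : N ^ 3 = K ^ 3 / ((-s) * Real.sqrt (-s)) := by
    rw [hN, div_pow]
    have : Real.sqrt (-s) ^ 3 = (-s) * Real.sqrt (-s) := by rw [pow_succ, hsq2]
    rw [this]
  have heq : M * (8 * ρ ^ 3 * V₁) =
      8 * V₁ * (C₂ * K ^ 2) * (ρ / (-s)) + 8 * V₁ * (C₁ * K ^ 3) * (ρ ^ 2 / ((-s) * Real.sqrt (-s))) +
        8 * V₁ * (2 * C₁ * K * A₁) * (ρ ^ 2 / (s ^ 2 * Real.sqrt (-s))) +
        8 * V₁ * (2 * C₁ * K * A₂) * (ρ ^ 2 * Real.sqrt (1 + 2 * ρ) / ((-s) * Real.sqrt (-s))) := by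
    rw [hM, hN3, hN2, hOsc, hN]
    field_simp
    ring
  have t1 : 0 ≤ ρ / (-s) := by positivity
  have t2 : 0 ≤ ρ ^ 2 / ((-s) * Real.sqrt (-s)) := by positivity
  have t3 : 0 ≤ ρ ^ 2 / (s ^ 2 * Real.sqrt (-s)) := by positivity
  have t4 : 0 ≤ ρ ^ 2 * Real.sqrt (1 + 2 * ρ) / ((-s) * Real.sqrt (-s)) := by positivity
  set B : ℝ := 8 * V₁ * (C₂ * K ^ 2 + C₁ * K ^ 3 + 2 * C₁ * K * A₁ + 2 * C₁ * K * A₂) with hB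
  have ha : 0 ≤ C₂ * K ^ 2 := by positivity
  have hb : 0 ≤ C₁ * K ^ 3 := by positivity
  have hc : 0 ≤ 2 * C₁ * K * A₁ := by positivity
  have hd : 0 ≤ 2 * C₁ * K * A₂ := by positivity
  have h8 : 0 ≤ 8 * V₁ := by positivity
  have c1 : 8 * V₁ * (C₂ * K ^ 2) ≤ B := mul_le_mul_of_nonneg_left (by linarith) h8
  have c2 : 8 * V₁ * (C₁ * K ^ 3) ≤ B := mul_le_mul_of_nonneg_left (by linarith) h8
  have c3 : 8 * V₁ * (2 * C₁ * K * A₁) ≤ B := mul_le_mul_of_nonneg_left (by linarith) h8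
  have c4 : 8 * V₁ * (2 * C₁ * K * A₂) ≤ B := mul_le_mul_of_nonneg_left (by linarith) h8
  calc (∫ x, f x) ≤ M * (8 * ρ ^ 3 * V₁) := hint
    _ = _ := heq
    _ ≤ B * (ρ / (-s)) + B * (ρ ^ 2 / ((-s) * Real.sqrt (-s))) + B * (ρ ^ 2 / (s ^ 2 * Real.sqrt (-s))) +
          B * (ρ ^ 2 * Real.sqrt (1 + 2 * ρ) / ((-s) * Real.sqrt (-s))) := by
        gcongr
    _ = B * (ρ / (-s) + ρ ^ 2 / ((-s) * Real.sqrt (-s)) + ρ ^ 2 / (s ^ 2 * Real.sqrt (-s)) +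
          ρ ^ 2 * Real.sqrt (1 + 2 * ρ) / ((-s) * Real.sqrt (-s))) := by ring

end Summit.NavierStokesRegularity.NavierStokesRegularity.Theorems.ExtremiserTransience

end
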